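import Summits.AtomisticToContinuum.Crystallization.Theses.PricedLinkCensus
import Literature.MathematicalPhysics.StatisticalMechanics.StablePotentialsProofs
import Literature.MathematicalPhysics.StatisticalMechanics.LennardJonesClusters
import Literature.Barriers.AtomisticToContinuum.SutoDegenerateGroundStates

/-!
# Disproof of `TruncatedCensusGap` — findings (cdisprove seat g2, crux `stmt-AtomisticToContinuum-14230`)

The crux (route `PricedLinkCensus`, rank 2):

  `TruncatedCensusGap : ∃ κ > 0, ∀ N (y : Fin N → ℝ³) injective,`
  `   N · e_χ* + κ · #{i | ¬ IsChargeFree (1/100) y i} ≤ E_χ(y)`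

with `V_χ r = min 1 (max 0 (4 - 2r)) · V_LJ r` (range-2 truncation of the tree's
`lennardJones r = r⁻¹²/12 - r⁻⁶/6`), `E_χ = interactionEnergy V_χ`, and
`e_χ* = ⨅ Q : PeriodicConfiguration 3, Q.energyPerParticle V_χ` (a `Real.iInf`).

VERDICT SO FAR: **resists disproof** — see the obstruction paragraph. Everything below is
sorry-free unless marked `near-miss`.

## What is certified in this file

* §0 the potential: `Vχ_zero` (`V_χ 0 = 0`, junk `0⁻¹ = 0`), `Vχ_one = -1/12`, `Vχ_eq_zero`
  (`r ≥ 2`), `Vχ_eq_lennardJones` (`r ≤ 3/2`), `lennardJones_le_Vχ`, `neg_one_div_le_Vχ`.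
* §1 small `N`: `not_isChargeFree_of_card_le` — with `≤ 12` sites NOBODY is charge-free (a
  charge-free site has 12 bonds); instances `gapAt_one : e_χ* + κ ≤ 0`,
  `gapAt_two : 2 e_χ* + 2κ ≤ -1/12`; so `e_χ* < 0` and `κ ≤ -e_χ*` are forced, no small-`N` kill
  (`E - N e_χ* ≥ 0` always and `-e_χ* ≈ 0.61 ≫ κ`).
* §2 LOAD-BEARING `Function.Injective`: `not_gapAtWithoutInjective` — dropping injectivity the
  inequality fails for EVERY `κ ≥ 0` and EVERY value of `e_χ*` (`M + M` points, `M` at `0` and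
  `M` at `e₀`: energy `-M²/12` because `V_χ 0 = 0`). Any proof uses distinctness quantitatively.
* §3 `bddBelow_of_gapAt` : the crux (even at `κ = 0`) IMPLIES `BddBelow (range e_χ(·))`, i.e.
  periodic stability of `V_χ`; without it `e_χ* = 0` (`Real.iInf_of_not_bddBelow`) and two
  points at distance `1` refute. Provers must land this bookkeeping first (cf. item 0714 for
  `V_LJ`).
* §4 `Vχ_stable` : finite-configuration stability of `V_χ` (`V_χ ≥ V_LJ` pointwise +
  `lennardJones_stable_holds`) — the finite half of that bookkeeping.
* §5 `gapAt_zero_iff_bddBelow` : **the `κ = 0` statement is EQUIVALENT to `BddBelow`** — the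
  energy half `N e_χ* ≤ E_χ(y)` carries no information beyond stability: periodise `y` with a
  cubic period `L ≥ diam y + 2` (`periodise`, `energyPerParticle_periodise`: the energy per
  particle of the periodised cluster is EXACTLY `E_χ(y)/N` since `V_χ` vanishes beyond `2`).
  Hence 100 % of the content of the crux is the defect price `κ > 0`, and `e_χ* ≤ E_χ(y)/N`
  for every finite cluster (`eStar_le_div`): `e_χ* = e_∞(V_χ)` from above is free.
* §6 the LEVER behind the numerics: `not_adj_of_lt` — if one bond at `j` is shorter than
  `dist(j,m)/(1+η)`, then `j ≁ m`; `not_isChargeFree_of_short_bond` — a site with one bond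
  compressed by more than the tolerance relative to all its other distances has `N(j) ⊆ {k}` and
  is charged. Compressing ONE bond by just over `1 %` therefore strips both of its end points of
  all their other bonds: 20 charged sites for a second-order elastic price.
* §7 NEAR-MISS (the only `sorry`): `periodic_pricing_of_gapAt` — the periodic form
  `e_χ(Q) ≥ e_χ* + κ · chargedPerCell Q / #F` in which the crux is numerically falsifiable; proof
  route and the missing block lemma are in the section docstring.

LANDED THROUGH THE GATE (def-free twins of §2, §3, §5, importable by provers/planners):
`Theorems/TruncatedCensusGap/Negative/KappaZeroHalf.lean` (p69766 ACCEPTED, commit 1d3a910b8f69: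
finite-range periodisation identity for ANY potential vanishing on `[R,∞)`,
`truncatedCensusGap_kappa_zero_iff_bddBelow`, `truncatedCensusGap_bddBelow`) and
`…/Negative/WithoutInjective.lean` (p69790 ACCEPTED, commit f05b3d97ec1d).

## Numerics (evidence files NUMERICS.md / kit jobs of seats rattack-14230, cdisprove g1, and this
seat; tree units, `min V = -1/12`)

* `e_χ(hcp) = -0.608669` at `a = 0.97707`, `c/a = 1.63142` (bond split 0.06 % ≪ 1 %, charge-free
  with margin); competitors: 9R `+8.2e-5`, dhcp `+1.2e-4`, fcc `+2.4e-4`, bcc `+2.9e-2`, σ `+5.6e-2`,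
  A15 `+8.0e-2`, Z/C14/C15 `≈ +0.1`; distortion paths (Bain, c/a, rhombohedral, layer offset)
  convex at the close-packed end points — no cut-off artefact minimiser found (g1, rattack).
* cheapest charged excitations (upper bounds on any valid `κ`, CONDITIONAL on `e_χ* = e_χ(hcp)`):
  relaxed compressed pair — 20 charged sites for `ΔE = 5.4e-4` ⇒ `κ ≤ 2.7e-5` (hcp) / `3.0e-5`
  (fcc); single push `κ ≤ 7e-5`; Bain `2 %` `4.5e-4` per site; vacancy `≈ 0.1` per site. All
  floors are `threshold² × phonon stiffness > 0`: nothing found drives `ΔE/#charged → 0`.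
  CONSEQUENCE FOR PROVERS: the card's per-face price list (`κ_q ≈ 2.6e-3` per missing square) is
  50–100× too optimistic; a site becomes charged by a 1 % GEOMETRIC threshold whose energy
  signature is second order (`≈ ½ V''(a)(0.01a)² ≈ 5e-4` per event, shared by 20 sites), not by a
  missing second-shell bond (`≈ 2.3e-2`). Any valid κ is an ELASTIC constant.

## Why it resists (the obstruction, for every refuting strategy)

`GapAt κ` is DOWNWARD CLOSED in the value of `e_χ*`: all its consequences are upper bounds on
`e_χ*` (§5) plus `BddBelow`. A refutation must therefore certify a LOWER bound on `e_χ*` sharp at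
the scale of the witness's excess energy — for the elastic witnesses above, `e_χ* ≥ e_χ(hcp) - 1e-6`
per particle, i.e. energetic crystallization for the range-2 potential in `d = 3` (open). The one
loophole not needing a lower bound is an energy density `→ -∞`, available only without
injectivity (§2). Small clusters cannot refute (`E - N e* ≥ 0`, `#charged ≤ N`, `-e* ≫ κ`).
Remaining physical risk (not certifiable either way): a periodic `V_χ`-minimiser that is not
charge-free at `1/100`, excluded numerically over all named TCP/FK competitors and distortion
paths; blind variable-cell searches: see NUMERICS (this seat's kit jobs).

Targets (lead's stuck stubs): none filed (payload.stuck_stubs = []).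
-/

noncomputable section

namespace Summit.AtomisticToContinuum.Crystallization.Cruxes.TruncatedCensusGap.Disproof

open Literature.MathematicalPhysics.StatisticalMechanics Literature.Geometry.DiscreteGeometry
open Literature.Barriers.AtomisticToContinuum (cubicLattice cubicBasis cubicBasis_apply)
open Summit.AtomisticToContinuum.Crystallization.Theses.PricedLinkCensus (TruncatedCensusGap)

/-! ## §0 The objects of the crux -/

/-- The range-2 truncated Lennard-Jones potential `V_χ = χ · V_LJ`, `χ r = min 1 (max 0 (4 - 2r))`. -/
def Vχ (r : ℝ) : ℝ := min 1 (max 0 (4 - 2 * r)) * lennardJones r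

/-- The periodic infimum `e_χ* = ⨅_Q e_χ(Q)` (a conditionally complete `iInf` on `ℝ`). -/
def eStar : ℝ := ⨅ Q : PeriodicConfiguration 3, Q.energyPerParticle Vχ

/-- The number of charged (= not charge-free at tolerance `1/100`) sites. -/
def charged {N : ℕ} (y : Fin N → EuclideanSpace ℝ (Fin 3)) : ℕ :=
  Nat.card {i : Fin N // ¬ IsChargeFree (1 / 100 : ℝ) y i}

/-- The crux at a fixed price `κ`. -/
def GapAt (κ : ℝ) : Prop :=
  ∀ (N : ℕ) (y : Fin N → EuclideanSpace ℝ (Fin 3)), Function.Injective y →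
    (N : ℝ) * eStar + κ * (charged y : ℝ) ≤ interactionEnergy Vχ y

/-- `TruncatedCensusGap ↔ ∃ κ > 0, GapAt κ` (definitional). -/
theorem tcg_iff : TruncatedCensusGap ↔ ∃ κ : ℝ, 0 < κ ∧ GapAt κ := Iff.rfl

/-- `GapAt` is monotone: a smaller price is easier. -/
theorem GapAt.mono {κ κ' : ℝ} (h : GapAt κ) (hle : κ' ≤ κ) : GapAt κ' := fun N y hy => by
  have h1 := h N y hy
  have h2 : κ' * (charged y : ℝ) ≤ κ * (charged y : ℝ) :=
    mul_le_mul_of_nonneg_right hle (Nat.cast_nonneg _)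
  linarith

theorem Vχ_def (r : ℝ) : Vχ r = min 1 (max 0 (4 - 2 * r)) * lennardJones r := rfl

/-- `V_χ 0 = 0`: the junk value `0⁻¹ = 0` of `V_LJ` survives the truncation. -/
theorem Vχ_zero : Vχ 0 = 0 := by simp [Vχ, lennardJones_zero]

/-- Up to `r = 3/2` the truncation is invisible. -/
theorem Vχ_eq_lennardJones {r : ℝ} (hr : r ≤ 3 / 2) : Vχ r = lennardJones r := by
  have h : min 1 (max 0 (4 - 2 * r)) = 1 := min_eq_left (le_max_of_le_right (by linarith))
  rw [Vχ, h, one_mul]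

/-- `V_χ 1 = -1/12`, the well depth. -/
theorem Vχ_one : Vχ 1 = -1 / 12 := by
  rw [Vχ_eq_lennardJones (by norm_num), lennardJones_one]

/-- Beyond `r = 2` the truncated potential vanishes. -/
theorem Vχ_eq_zero {r : ℝ} (hr : 2 ≤ r) : Vχ r = 0 := by
  have h : max 0 (4 - 2 * r) = 0 := max_eq_left (by linarith)
  simp [Vχ, h]

theorem chi_le_one (r : ℝ) : min 1 (max 0 (4 - 2 * r)) ≤ 1 := min_le_left _ _

theorem chi_nonneg (r : ℝ) : 0 ≤ min 1 (max 0 (4 - 2 * r)) := le_min zero_le_one (le_max_left _ _)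

/-- `V_LJ ≤ V_χ` pointwise (`χ = 1` wherever `V_LJ > 0`, and `χ ≤ 1` where `V_LJ ≤ 0`). -/
theorem lennardJones_le_Vχ (r : ℝ) : lennardJones r ≤ Vχ r := by
  rcases le_or_gt (lennardJones r) 0 with h | h
  · have := mul_le_mul_of_nonpos_right (chi_le_one r) h
    simpa [Vχ] using this
  · rcases le_or_gt r (3 / 2) with hr | hr
    · rw [Vχ_eq_lennardJones hr]
    · have : lennardJones r ≤ 0 := lennardJones_nonpos (by linarith)
      linarith

/-- `V_χ ≥ -1/12`. -/
theorem neg_one_div_le_Vχ (r : ℝ) : -1 / 12 ≤ Vχ r :=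
  (neg_one_div_le_lennardJones r).trans (lennardJones_le_Vχ r)

/-! ## §1 Small `N`: nobody is charge-free among `≤ 12` sites; the `N = 1, 2` instances -/

/-- A site is never its own neighbour, so it has fewer bonds than there are sites. -/
theorem ncard_neighborSet_lt_card {ι X : Type*} [PseudoMetricSpace X] [Finite ι] (η : ℝ)
    (y : ι → X) (i : ι) : ((bondGraph η y).neighborSet i).ncard < Nat.card ι := by
  rw [← Set.ncard_univ]
  refine Set.ncard_lt_ncard ⟨Set.subset_univ _, fun h => ?_⟩ Set.finite_univ
  have hi : i ∈ (bondGraph η y).neighborSet i := h (Set.mem_univ i)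
  exact (bondGraph η y).irrefl ((SimpleGraph.mem_neighborSet _ _ _).1 hi)

/-- **With at most `12` sites no site is charge-free** (at any tolerance): charge-freeness asks
for `12` bonds. In particular every cluster with `N ≤ 12` has all its `N` sites charged. -/
theorem not_isChargeFree_of_card_le {ι X : Type*} [PseudoMetricSpace X] [Finite ι]
    (hι : Nat.card ι ≤ 12) (η : ℝ) (y : ι → X) (i : ι) : ¬ IsChargeFree η y i := fun h => by
  have := ncard_neighborSet_lt_card η y i
  have h12 := h.1
  omega

/-- Hence `#charged = N` for `N ≤ 12`. -/
theorem charged_eq_of_le {N : ℕ} (hN : N ≤ 12) (y : Fin N → EuclideanSpace ℝ (Fin 3)) :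
    charged y = N := by
  unfold charged
  have hall : ∀ i : Fin N, ¬ IsChargeFree (1 / 100 : ℝ) y i :=
    not_isChargeFree_of_card_le (by simpa using hN) _ y
  rw [Nat.card_congr (Equiv.subtypeUnivEquiv hall), Nat.card_eq_fintype_card, Fintype.card_fin]

/-- The energy of a constant (totally coincident) configuration vanishes, `V_χ 0 = 0`. -/
theorem interactionEnergy_const {N : ℕ} (p : EuclideanSpace ℝ (Fin 3)) :
    interactionEnergy Vχ (fun _ : Fin N => p) = 0 := by
  simp [interactionEnergy, Vχ_zero]

/-- `N = 1`: the single site is charged and has energy `0`, so `e_χ* + κ ≤ 0`. -/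
theorem gapAt_one {κ : ℝ} (h : GapAt κ) : eStar + κ ≤ 0 := by
  have h1 := h 1 (fun _ => 0) (fun i j _ => Subsingleton.elim i j)
  rw [charged_eq_of_le (by norm_num), interactionEnergy_const] at h1
  push_cast at h1
  linarith

/-- The unit vector `e₀`. -/
def e0 : EuclideanSpace ℝ (Fin 3) := EuclideanSpace.single 0 1

theorem norm_e0 : ‖e0‖ = 1 := by simp [e0]

theorem dist_zero_e0 : dist (0 : EuclideanSpace ℝ (Fin 3)) e0 = 1 := by
  rw [dist_comm, dist_zero_right, norm_e0]

theorem e0_ne_zero : e0 ≠ 0 := fun h => by simpa [h] using norm_e0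

/-- `M` points at `0` followed by `M` points at `e₀`. -/
def twoPoles (M : ℕ) : Fin (M + M) → EuclideanSpace ℝ (Fin 3) :=
  Fin.append (fun _ : Fin M => (0 : EuclideanSpace ℝ (Fin 3))) (fun _ : Fin M => e0)

/-- Its energy: only the `M²` cross pairs (at distance `1`) contribute, `E = -M²/12`. -/
theorem interactionEnergy_twoPoles (M : ℕ) :
    interactionEnergy Vχ (twoPoles M) = -((M : ℝ) * M / 12) := by
  rw [twoPoles, interactionEnergy_append Vχ Vχ_zero, interactionEnergy_const,
    interactionEnergy_const]
  simp only [dist_zero_e0, Vχ_one, Finset.sum_const, Finset.card_univ, Fintype.card_fin,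
    nsmul_eq_mul]
  ring

/-- `twoPoles 1` is the injective two-point configuration `{0, e₀}`. -/
theorem twoPoles_one_injective : Function.Injective (twoPoles 1) := by
  intro i j hij
  have key : ∀ k : Fin (1 + 1), twoPoles 1 k = if (k : ℕ) = 0 then 0 else e0 := by
    intro k
    unfold twoPoles
    refine Fin.addCases (fun l => ?_) (fun l => ?_) k
    · rw [Fin.append_left]; simp [Subsingleton.elim l 0]
    · rw [Fin.append_right]; simp [Subsingleton.elim l 0]
  rw [key, key] at hij
  apply Fin.ext
  by_contra hne
  have hi := i.isLt
  have hj := j.isLt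
  split_ifs at hij with h1 h2 h2
  · omega
  · exact e0_ne_zero hij.symm
  · exact e0_ne_zero hij
  · omega

/-- `N = 2` at distance `1`: both sites charged, energy `-1/12`, so `2 e_χ* + 2κ ≤ -1/12`. -/
theorem gapAt_two {κ : ℝ} (h : GapAt κ) : 2 * eStar + 2 * κ ≤ -1 / 12 := by
  have h2 := h (1 + 1) (twoPoles 1) twoPoles_one_injective
  rw [charged_eq_of_le (by norm_num), interactionEnergy_twoPoles] at h2
  push_cast at h2
  linarith

/-- Consequently the crux forces `e_χ* ≤ -1/24 - κ < 0`. -/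
theorem eStar_lt_zero {κ : ℝ} (hκ : 0 ≤ κ) (h : GapAt κ) : eStar < 0 := by
  have := gapAt_two h
  linarith

/-! ## §2 Load-bearing hypothesis: `Function.Injective` -/

/-- The crux at price `κ` with injectivity DROPPED. -/
def GapAtWithoutInjective (κ : ℝ) : Prop :=
  ∀ (N : ℕ) (y : Fin N → EuclideanSpace ℝ (Fin 3)),
    (N : ℝ) * eStar + κ * (charged y : ℝ) ≤ interactionEnergy Vχ y

/-- `TruncatedCensusGap` with injectivity dropped. -/
def TruncatedCensusGapWithoutInjective : Prop := ∃ κ : ℝ, 0 < κ ∧ GapAtWithoutInjective κ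

/-- **Injectivity is load-bearing, for every `κ ≥ 0` and whatever the value of `e_χ*`:**
`M + M` coincident points at the two ends of a unit segment have energy `-M²/12`, an energy
DENSITY `-M/24 → -∞`, below `N · e_χ*` for `M > -24 e_χ*`. (The only refuting mechanism that
needs no lower bound on `e_χ*`.) -/
theorem not_gapAtWithoutInjective {κ : ℝ} (hκ : 0 ≤ κ) : ¬ GapAtWithoutInjective κ := by
  intro h
  obtain ⟨M, hM⟩ := exists_nat_gt (-24 * eStar)
  have hM1 : (1 : ℝ) ≤ M + 1 := by linarith [(Nat.cast_nonneg M : (0 : ℝ) ≤ M)]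
  have key := h (M + 1 + (M + 1)) (twoPoles (M + 1))
  rw [interactionEnergy_twoPoles] at key
  have hc : (0 : ℝ) ≤ κ * (charged (twoPoles (M + 1)) : ℝ) :=
    mul_nonneg hκ (Nat.cast_nonneg _)
  push_cast at key
  -- `2 (M+1) e* ≤ -(M+1)²/12`, i.e. `e* ≤ -(M+1)/24 < -M/24 < e*`
  nlinarith

/-- Hence `¬ TruncatedCensusGapWithoutInjective`. -/
theorem truncatedCensusGap_false_without_injective : ¬ TruncatedCensusGapWithoutInjective :=
  fun ⟨_, hκ, h⟩ => not_gapAtWithoutInjective hκ.le h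

/-! ## §3 The crux implies periodic stability (`BddBelow`), even at `κ = 0` -/

/-- **Any `GapAt κ`, `κ ≥ 0`, implies `BddBelow (range e_χ)`.** Otherwise `e_χ* = 0` by the
`Real.iInf` junk convention and `gapAt_two` reads `2κ ≤ -1/12`. So a proof of the crux must
FIRST establish periodic stability of `V_χ` (bookkeeping twin of item 0714 for `V_LJ`). -/
theorem bddBelow_of_gapAt {κ : ℝ} (hκ : 0 ≤ κ) (h : GapAt κ) :
    BddBelow (Set.range fun Q : PeriodicConfiguration 3 => Q.energyPerParticle Vχ) := by
  by_contra hB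
  have h0 : eStar = 0 := Real.iInf_of_not_bddBelow hB
  have h2 := gapAt_two h
  rw [h0] at h2
  linarith

theorem bddBelow_of_tcg (h : TruncatedCensusGap) :
    BddBelow (Set.range fun Q : PeriodicConfiguration 3 => Q.energyPerParticle Vχ) := by
  obtain ⟨κ, hκ, h⟩ := tcg_iff.1 h
  exact bddBelow_of_gapAt hκ.le h

/-! ## §4 Finite-configuration stability of `V_χ` (the finite half of `BddBelow`) -/

/-- The interaction energy is monotone in the potential. -/
theorem interactionEnergy_mono {V W : ℝ → ℝ} (hVW : ∀ r, V r ≤ W r) {d N : ℕ}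
    (x : Fin N → EuclideanSpace ℝ (Fin d)) : interactionEnergy V x ≤ interactionEnergy W x :=
  Finset.sum_le_sum fun _ _ => Finset.sum_le_sum fun _ _ => hVW _

/-- **`V_χ` is stable on finite configurations**: `E_χ(x) ≥ -C N` with the Lennard-Jones
stability constant (`lennardJones_stable_holds`, proved in the tree), since `V_χ ≥ V_LJ`. -/
theorem Vχ_stable : ∃ C : ℝ, ∀ (N : ℕ) (x : Fin N → EuclideanSpace ℝ (Fin 3)),
    Function.Injective x → -(C * (N : ℝ)) ≤ interactionEnergy Vχ x := by
  obtain ⟨C, hC⟩ := lennardJones_stable_holds 3 (by norm_num)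
  exact ⟨C, fun N x hx => (hC N x hx).trans (interactionEnergy_mono lennardJones_le_Vχ x)⟩

/-! ## §5 Periodisation: the `κ = 0` statement is exactly `BddBelow` -/

section Periodise

variable {N : ℕ}

/-- Coordinates of vectors of the cubic lattice `cℤ³` are integer multiples of `c`. -/
theorem exists_int_apply_of_mem_cubicLattice {c : ℝˣ} {g : EuclideanSpace ℝ (Fin 3)}
    (hg : g ∈ cubicLattice c) (i : Fin 3) : ∃ n : ℤ, g i = (c : ℝ) * n := by
  unfold Literature.Barriers.AtomisticToContinuum.cubicLattice at hg
  induction hg using Submodule.span_induction with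
  | mem x hx =>
    obtain ⟨j, rfl⟩ := hx
    refine ⟨if i = j then 1 else 0, ?_⟩
    rw [cubicBasis_apply]
    split_ifs with hij
    · subst hij; simp
    · simp [hij]
  | zero => exact ⟨0, by simp⟩
  | add x x' _ _ hx hx' =>
    obtain ⟨m, hm⟩ := hx
    obtain ⟨n, hn⟩ := hx'
    exact ⟨m + n, by simp [hm, hn]; ring⟩
  | smul a x _ hx =>
    obtain ⟨m, hm⟩ := hx
    refine ⟨a * m, ?_⟩
    rw [← Int.cast_smul_eq_zsmul ℝ a x]
    simp [hm]
    ring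

/-- Nonzero vectors of `cℤ³` (`c > 0`) have norm at least `c`. -/
theorem le_norm_of_mem_cubicLattice {c : ℝˣ} (hc : 0 < (c : ℝ)) {g : EuclideanSpace ℝ (Fin 3)}
    (hg : g ∈ cubicLattice c) (hg0 : g ≠ 0) : (c : ℝ) ≤ ‖g‖ := by
  obtain ⟨i, hi⟩ : ∃ i, g i ≠ 0 := by
    by_contra h
    simp only [not_exists, not_not] at h
    exact hg0 (PiLp.ext h)
  obtain ⟨n, hn⟩ := exists_int_apply_of_mem_cubicLattice hg i
  have hn0 : n ≠ 0 := by
    rintro rfl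
    simp [hn] at hi
  have h1 : (1 : ℝ) ≤ |(n : ℝ)| := by exact_mod_cast Int.one_le_abs hn0
  calc (c : ℝ) ≤ (c : ℝ) * |(n : ℝ)| := le_mul_of_one_le_right hc.le h1
    _ = ‖g i‖ := by rw [hn, Real.norm_eq_abs, abs_mul, abs_of_pos hc]
    _ ≤ ‖g‖ := PiLp.norm_apply_le g i

/-- **Periodisation.** The cubic periodisation, with period `L`, of a finite configuration all of
whose mutual distances are `< L`: lattice `Lℤ³`, motif = the points of the configuration. -/
def periodise (y : Fin N → EuclideanSpace ℝ (Fin 3)) (hN : 0 < N) (L : ℝ) (hL : 0 < L)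
    (hyL : ∀ i j, ‖y i - y j‖ < L) : PeriodicConfiguration 3 where
  lattice := cubicLattice (Units.mk0 L hL.ne')
  discrete := inferInstance
  isZLattice := inferInstance
  motif := Finset.univ.image y
  motif_nonempty := by
    haveI : Nonempty (Fin N) := ⟨⟨0, hN⟩⟩
    exact Finset.univ_nonempty.image y
  eq_of_sub_mem := by
    intro x hx x' hx' hsub
    obtain ⟨i, -, rfl⟩ := Finset.mem_image.1 hx
    obtain ⟨j, -, rfl⟩ := Finset.mem_image.1 hx'
    by_contra hne
    have h := le_norm_of_mem_cubicLattice (c := Units.mk0 L hL.ne') hL hsub (sub_ne_zero.2 hne)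
    simp only [Units.val_mk0] at h
    linarith [hyL i j]

/-- In the periodisation with `L ≥ (mutual distances) + 2`, a point of the configuration sees,
within the range `2` of `V_χ`, only the other points of its own copy: the inner lattice sum of
`energyPerParticle` is the finite site energy. -/
theorem tsum_periodise_eq_siteEnergy (y : Fin N → EuclideanSpace ℝ (Fin 3))
    (hy : Function.Injective y) (hN : 0 < N) (L : ℝ) (hL : 0 < L)
    (hyL : ∀ i j, ‖y i - y j‖ + 2 ≤ L) (i : Fin N) :
    (∑' z : {z : EuclideanSpace ℝ (Fin 3) //
        z ∈ (periodise y hN L hL (fun i j => by linarith [hyL i j])).points ∧ z ≠ y i},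
        Vχ (dist (y i) z.1)) = siteEnergy Vχ y i := by
  classical
  set P := periodise y hN L hL (fun i j => by linarith [hyL i j])
  have hmem : ∀ j : Fin N, j ≠ i → (y j ∈ P.points ∧ y j ≠ y i) := fun j hji =>
    ⟨P.mem_points_of_mem_motif (Finset.mem_image_of_mem y (Finset.mem_univ j)),
      fun h => hji (hy h)⟩
  -- the other sites of the cluster, embedded into the index type of the lattice sum
  let emb : {j // j ∈ Finset.univ.erase i} ↪
      {z : EuclideanSpace ℝ (Fin 3) // z ∈ P.points ∧ z ≠ y i} :=
    ⟨fun j => ⟨y j.1, hmem j.1 (Finset.ne_of_mem_erase j.2)⟩, fun j k h =>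
      Subtype.ext (hy (congrArg Subtype.val h))⟩
  rw [tsum_eq_sum (s := (Finset.univ.erase i).attach.map emb) ?_]
  · rw [Finset.sum_map]
    exact Finset.sum_attach (Finset.univ.erase i) (fun j => Vχ (dist (y i) (y j)))
  · intro z hz
    obtain ⟨x, hx, g, hg, hz'⟩ := z.2.1
    obtain ⟨j, -, rfl⟩ := Finset.mem_image.1 hx
    have hg0 : g ≠ 0 := by
      rintro rfl
      apply hz
      have hji : j ≠ i := by
        rintro rfl
        exact z.2.2 (by rw [hz', add_zero])
      rw [Finset.mem_map]
      exact ⟨⟨j, Finset.mem_erase.2 ⟨hji, Finset.mem_univ j⟩⟩, Finset.mem_attach _ _,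
        Subtype.ext (by rw [hz', add_zero]; rfl)⟩
    apply Vχ_eq_zero
    have hgL : L ≤ ‖g‖ := by
      simpa using le_norm_of_mem_cubicLattice (c := Units.mk0 L hL.ne') hL hg hg0
    have h1 : ‖g‖ ≤ ‖g + (y j - y i)‖ + ‖y j - y i‖ := by
      simpa using norm_sub_le (g + (y j - y i)) (y j - y i)
    have h2 : dist (y i) z.1 = ‖g + (y j - y i)‖ := by
      rw [hz', dist_eq_norm, ← norm_neg]
      congr 1
      abel
    linarith [hyL j i]

/-- **The energy per particle of the periodised cluster is exactly `E_χ(y)/N`.** -/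
theorem energyPerParticle_periodise (y : Fin N → EuclideanSpace ℝ (Fin 3))
    (hy : Function.Injective y) (hN : 0 < N) (L : ℝ) (hL : 0 < L)
    (hyL : ∀ i j, ‖y i - y j‖ + 2 ≤ L) :
    (periodise y hN L hL (fun i j => by linarith [hyL i j])).energyPerParticle Vχ =
      interactionEnergy Vχ y / N := by
  have hcard : (periodise y hN L hL (fun i j => by linarith [hyL i j])).motif.card = N := by
    show (Finset.univ.image y).card = N
    rw [Finset.card_image_of_injective _ hy, Finset.card_univ, Fintype.card_fin]
  have hsum : (∑ x ∈ (periodise y hN L hL (fun i j => by linarith [hyL i j])).motif,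
      ∑' z : {z : EuclideanSpace ℝ (Fin 3) //
        z ∈ (periodise y hN L hL (fun i j => by linarith [hyL i j])).points ∧ z ≠ x},
        Vχ (dist x z.1)) = 2 * interactionEnergy Vχ y := by
    show (∑ x ∈ Finset.univ.image y, _) = _
    rw [Finset.sum_image (fun j _ k _ h => hy h), two_mul_interactionEnergy]
    exact Finset.sum_congr rfl fun i _ => tsum_periodise_eq_siteEnergy y hy hN L hL hyL i
  unfold PeriodicConfiguration.energyPerParticle
  rw [hcard, hsum]
  have hN' : (N : ℝ) ≠ 0 := by exact_mod_cast hN.ne'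
  field_simp

/-- A period that is large enough: `L = 3 + 2 Σ_k ‖y k‖`. -/
theorem norm_sub_add_two_le (y : Fin N → EuclideanSpace ℝ (Fin 3)) (i j : Fin N) :
    ‖y i - y j‖ + 2 ≤ 3 + 2 * ∑ k, ‖y k‖ := by
  have hi : ‖y i‖ ≤ ∑ k, ‖y k‖ :=
    Finset.single_le_sum (fun k _ => norm_nonneg (y k)) (Finset.mem_univ i)
  have hj : ‖y j‖ ≤ ∑ k, ‖y k‖ :=
    Finset.single_le_sum (fun k _ => norm_nonneg (y k)) (Finset.mem_univ j)
  linarith [norm_sub_le (y i) (y j)]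

/-- **`e_χ* ≤ E_χ(y)/N` for every finite injective cluster** (`N ≥ 1`), given only periodic
stability: the upper half of `e_χ* = e_∞(V_χ)` is elementary for the finite-range potential. -/
theorem eStar_le_div
    (hB : BddBelow (Set.range fun Q : PeriodicConfiguration 3 => Q.energyPerParticle Vχ))
    (hN : 0 < N) {y : Fin N → EuclideanSpace ℝ (Fin 3)} (hy : Function.Injective y) :
    eStar ≤ interactionEnergy Vχ y / N := by
  have hL : (0 : ℝ) < 3 + 2 * ∑ k, ‖y k‖ := by positivity
  rw [← energyPerParticle_periodise y hy hN _ hL (norm_sub_add_two_le y)]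
  exact ciInf_le hB _

end Periodise

/-- **The `κ = 0` statement is EQUIVALENT to periodic stability of `V_χ`.** So the energy
inequality `N · e_χ* ≤ E_χ(y)` of the crux is pure bookkeeping; all content is the price `κ > 0`. -/
theorem gapAt_zero_iff_bddBelow :
    GapAt 0 ↔ BddBelow (Set.range fun Q : PeriodicConfiguration 3 => Q.energyPerParticle Vχ) := by
  refine ⟨bddBelow_of_gapAt le_rfl, fun hB N y hy => ?_⟩
  rw [zero_mul, add_zero]
  rcases Nat.eq_zero_or_pos N with rfl | hN
  · simp [interactionEnergy]
  · have h := eStar_le_div hB hN hy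
    rwa [le_div_iff₀ (by exact_mod_cast hN), mul_comm] at h

/-- The crux therefore reads: `BddBelow ∧ (∃ κ > 0, the price inequality)`; its `κ = 0` shadow
`GapAt 0` follows from it (`GapAt.mono`) and is already equivalent to `BddBelow`. -/
theorem gapAt_zero_of_tcg (h : TruncatedCensusGap) : GapAt 0 := by
  obtain ⟨κ, hκ, h⟩ := tcg_iff.1 h
  exact h.mono hκ.le

/-! ## §6 The lever of the numerics: one short bond kills all longer ones at the same site -/

/-- **The `min(nn_j, nn_m)` rule.** If some site `k ≠ j` is closer to `j` than
`dist(j,m)/(1+η)`, then `j` and `m` are NOT bonded — whatever `m`'s own scale. With `η = 1/100`: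
compressing one bond at `j` by just over `1 %` strips `j` of its eleven other bonds (each of whose
far ends loses a bond and becomes charged): the 20-charged-sites-for-`5e-4` witness of NUMERICS. -/
theorem not_adj_of_lt {ι X : Type*} [PseudoMetricSpace X] {η : ℝ} (hη : 0 ≤ 1 + η)
    {y : ι → X} {j k m : ι} (hkj : k ≠ j)
    (hlt : (1 + η) * dist (y j) (y k) < dist (y j) (y m)) : ¬ (bondGraph η y).Adj j m := by
  intro hadj
  have h1 : dist (y j) (y m) ≤ (1 + η) * nearestDist y j := dist_le_of_adj hη hadj
  have h2 : nearestDist y j ≤ dist (y j) (y k) := nearestDist_le_dist y hkj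
  have h3 : (1 + η) * nearestDist y j ≤ (1 + η) * dist (y j) (y k) :=
    mul_le_mul_of_nonneg_left h2 hη
  linarith

/-- Contrapositive, the form used when reading bond graphs: every bond at `j` is at most
`(1+η)` times ANY other distance from `j`. -/
theorem dist_le_mul_dist_of_adj {ι X : Type*} [PseudoMetricSpace X] {η : ℝ} (hη : 0 ≤ 1 + η)
    {y : ι → X} {j k m : ι} (hkj : k ≠ j) (hadj : (bondGraph η y).Adj j m) :
    dist (y j) (y m) ≤ (1 + η) * dist (y j) (y k) := by
  by_contra hlt
  exact not_adj_of_lt hη hkj (lt_of_not_ge hlt) hadj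

/-- **One compressed bond isolates its end point in the bond graph.** If `k ≠ j` is closer to
`j` than every other site by a factor `> 1 + η`, then `N(j) ⊆ {k}`. -/
theorem neighborSet_subset_of_short_bond {ι X : Type*} [PseudoMetricSpace X] {η : ℝ}
    (hη : 0 ≤ 1 + η) {y : ι → X} {j k : ι} (hkj : k ≠ j)
    (h : ∀ m, m ≠ j → m ≠ k → (1 + η) * dist (y j) (y k) < dist (y j) (y m)) :
    (bondGraph η y).neighborSet j ⊆ {k} := by
  intro m hm
  rw [SimpleGraph.mem_neighborSet] at hm
  by_contra hmk
  have hmj : m ≠ j := by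
    rintro rfl
    exact (bondGraph η y).irrefl hm
  exact not_adj_of_lt hη hkj (h m hmj hmk) hm

/-- **… hence such a site is charged** (it has at most one bond, not twelve). In a close-packed
crystal, moving `j` and `k` towards each other by just over `η/2 · a` each realises the
hypothesis at BOTH ends (all other distances from `j` stay `≥ a (1 - η/2 · cos θ) > (1+η) · a(1-η)`
up to second order): `j`, `k` and their `18` former neighbours (each loses a bond) are charged —
`20` charged sites for the elastic price of one `1 %`-compressed bond, `≈ 5e-4` (NUMERICS). -/
theorem not_isChargeFree_of_short_bond {ι X : Type*} [PseudoMetricSpace X] {η : ℝ}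
    (hη : 0 ≤ 1 + η) {y : ι → X} {j k : ι} (hkj : k ≠ j)
    (h : ∀ m, m ≠ j → m ≠ k → (1 + η) * dist (y j) (y k) < dist (y j) (y m)) :
    ¬ IsChargeFree η y j := fun hcf => by
  have h1 : ((bondGraph η y).neighborSet j).ncard ≤ ({k} : Set ι).ncard :=
    Set.ncard_le_ncard (neighborSet_subset_of_short_bond hη hkj h) (Set.finite_singleton k)
  rw [Set.ncard_singleton, hcf.1] at h1
  omega

/-! ## §7 Near-miss (not closed): the periodic form of the crux

`GapAt κ` speaks about finite clusters, but its content for the numerics is the PERIODIC pricing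
below: every periodic configuration pays `κ` per charged site of its cell above `e_χ*`.  Proof
route (standard, not formalised): take the `k³`-cell blocks `B_k` of `Q` as the clusters `y`;
`E_χ(B_k) = k³ #F · e_χ(Q) - ½ X_k` with the cross term `|X_k| ≤ (1/12) · #{pairs across ∂B_k
within range 2} = O(k²)`; charge is LOCAL (the status of a site is decided by the configuration
within `≈ 3.1 · (1+η)² · max nn` of it, from `bondGraph_adj` / `ringNumber_def`), so
`#charged(B_k) = k³ · chargedPerCell Q + O(k²)`; divide by `k³ #F` and let `k → ∞`.
OBSTRUCTION TO FORMALISING (honest): block configurations of a general `PeriodicConfiguration`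
(a `ℤ`-basis of `Q.lattice`, `finrank_lattice`; lattice-point counting in dilated fundamental
domains) are not in the tree (~500 lines); nothing conceptual.  It is recorded because it is the
form in which the crux is numerically falsifiable (cheapest-falsifier protocol of the route) and
in which the κ-ceilings of NUMERICS are stated. -/

/-- Charged sites per cell of a periodic configuration: motif points that are not charge-free in
the INFINITE point set `Q.points` (tolerance `1/100`). -/
def chargedPerCell (Q : PeriodicConfiguration 3) : ℕ :=
  Nat.card {z : Q.points // z.1 ∈ Q.motif ∧
    ¬ IsChargeFree (1 / 100 : ℝ) (Subtype.val : Q.points → EuclideanSpace ℝ (Fin 3)) z}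

/-- NEAR-MISS (see the section docstring for the proof route and the missing block lemma):
**periodic pricing** — under `GapAt κ`, every periodic configuration satisfies
`e_χ(Q) ≥ e_χ* + κ · chargedPerCell Q / #F`.  In particular a periodic configuration all of
whose sites are charged (uniform shear of hcp by just over `1 %`: `Δe ≈ 1.5e-4`; or the
compressed-pair supercell: `Δe = 5.4e-4` per 20 charged) bounds `κ ≤ (e_χ(Q) - e_χ*) · #F /
chargedPerCell` — whence `κ ≲ 3e-5` IF `e_χ* = e_χ(hcp)`. -/
theorem periodic_pricing_of_gapAt {κ : ℝ} (hκ : 0 ≤ κ) (h : GapAt κ)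
    (Q : PeriodicConfiguration 3) :
    eStar + κ * (chargedPerCell Q : ℝ) / Q.motif.card ≤ Q.energyPerParticle Vχ := by
  sorry

end Summit.AtomisticToContinuum.Crystallization.Cruxes.TruncatedCensusGap.Disproof

end
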